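import Summits.CriticalPhenomena.PercolationContinuityZ3.Theorems.PercNearOneGluingNoHeavyLowerTailSahiJoinAbsorption
import Summits.CriticalPhenomena.PercolationContinuityZ3.Theorems.PercNearOneGluingNoHeavyLowerTailSahiHittingWidthFive
import Summits.CriticalPhenomena.PercolationContinuityZ3.Theorems.PercNearOneGluingNoHeavyLowerTailSahiHittingMoments
import HarnessLib

/-!
# `NoHeavyLowerTail` (stmt-CriticalPhenomena-4575) — JOIN ABSORPTION FOR HITTING EVENTS: every order, every product measure

Support file, seat `prim-l12-p5` (gen 12), `--supports stmt-CriticalPhenomena-4575`, COMPUTATIONAL only through the imported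
width-5 theorem (kernel certificates of the hitting `C₄`, `C₅`); the absorption statements themselves are standard-axiom
consequences of `…SahiJoinAbsorption`.  No definitions, no named facts, no sorries.

Hitting events `H_A = {ω | ∃ a ∈ A, a ∈ ω}` of finite sets `A ⊆ ι` under the product weight `bernoulliWeight p` on `2^ι`.
If `A ⊆ B` then `H_A ⊆ H_B`, i.e. `1_{H_A} · 1_{H_B} = 1_{H_A}`: the hitting event of a SUPERSET absorbs.  Hence
(`…SahiJoinAbsorption.sahiE_joinFam_eq`): for a CORE `A_0,…,A_k` and any number of sets `B_0,…,B_{m−1}` each containing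
EVERY core set,
  `E_{k+1+m}(1_{H_{B_0}},…,1_{H_{B_{m−1}}}, 1_{H_{A_0}},…,1_{H_{A_k}}) = Φ_{k+1}(H_B) · E_{k+1}(1_{H_{A_0}},…,1_{H_{A_k}})`, `Φ ≥ 0`.

* `prodBernoulli_sahiE_hit_joinFam_nonneg` — heredity: `E_{k+1}(H_A) ≥ 0` ⇒ the joined family is `≥ 0` at order `k+1+m`.
* **`prodBernoulli_sahiE_hit_joinFam_nonneg_of_core_width_le_five`** — UNCONDITIONAL for every core of width ≤ 5 (among any six
  core indices two nested; e.g. any core of ≤ 5 sets, `…_of_core_card_le_five`): Sahi positivity at EVERY order, for EVERY product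
  measure, of "a width-≤-5 hitting family together with arbitrarily many hitting events of supersets of all its sets" — a class of
  unbounded width not covered by `…SahiHittingWidthFive` / `…CoreTrace` (the supersets are pairwise incomparable in general).
* `cov_hit_eq` — `Cov(1_{H_A}, 1_{H_B}) = Π_{A∪B}(1−p) − Π_A(1−p)·Π_B(1−p)`; **`prodBernoulli_sahiE_hit_eq_zero_of_disjoint_core`** —
  for DISJOINT `A_0, A_1` and `B_i ⊇ A_0 ∪ A_1`: `E_{m+2}(H_B, H_{A_0}, H_{A_1}) = 0` identically in `p` (the identically-zero
  tensor-Bernstein classes of the universal hitting polynomials, e.g. the star `E_4(X∨Y∨Z, X, Y, Z)` after one more absorption step,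
  and `E_4(X, Y, X∨Y, X∨Y)`), and `…_nonneg_two_core` — with a two-set core the joined family is `≥ 0` at every order (Harris).
Slot order is immaterial (`Literature.…Sahi2008.sahiE_comp_perm`); the statements use the `joinFam` / `Fin.snoc` placements of
`…SahiJoinAbsorption`. [this work]
-/

namespace Summit.CriticalPhenomena.PercolationContinuityZ3.Theorems

namespace SahiHitting

open Finset Function Literature.Combinatorics.Sahi2008 SahiJoinAbsorption
open Literature.Probability.Percolation.DecisionTree (ind ind_of_mem ind_of_not_mem ind_nonneg ind_mul_ind_of_subset)

variable {ι : Type*} [Fintype ι] [DecidableEq ι]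

omit [Fintype ι] [DecidableEq ι] in
/-- `A ⊆ B ⇒ H_A ⊆ H_B`. [folklore] -/
theorem hitSet_mono {A B : Finset ι} (h : A ⊆ B) :
    {ω : Set ι | ∃ a ∈ A, a ∈ ω} ⊆ {ω : Set ι | ∃ a ∈ B, a ∈ ω} :=
  fun _ ⟨a, ha, haω⟩ => ⟨a, h ha, haω⟩

omit [Fintype ι] [DecidableEq ι] in
/-- **A superset's hitting event absorbs**: `1_{H_A} · 1_{H_B} = 1_{H_A}` for `A ⊆ B`. [folklore] -/
theorem ind_hit_mul_ind_hit_of_subset {A B : Finset ι} (h : A ⊆ B) :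
    (ind {ω : Set ι | ∃ a ∈ A, a ∈ ω}) * (ind {ω : Set ι | ∃ a ∈ B, a ∈ ω}) = ind {ω : Set ι | ∃ a ∈ A, a ∈ ω} := by
  funext ω
  rw [Pi.mul_apply, mul_comm]
  exact ind_mul_ind_of_subset (hitSet_mono h) ω

omit [DecidableEq ι] in
/-- **Heredity for hitting events**: if the core `H_{A_0},…,H_{A_k}` has `E_{k+1} ≥ 0` and every `B_i` contains every `A_j`, then
`E_{k+1+m}(1_{H_{B_0}},…,1_{H_{B_{m−1}}},1_{H_{A_0}},…,1_{H_{A_k}}) ≥ 0`. [this work] -/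
theorem prodBernoulli_sahiE_hit_joinFam_nonneg (p : ι → unitInterval) {k m : ℕ} (A : Fin (k + 1) → Finset ι)
    (B : Fin m → Finset ι) (hAB : ∀ i j, A j ⊆ B i)
    (hA : 0 ≤ sahiE (bernoulliWeight p) (k + 1) (fun j => ind {ω : Set ι | ∃ a ∈ A j, a ∈ ω})) :
    0 ≤ sahiE (bernoulliWeight p) (k + m + 1)
      (joinFam (fun i => ind {ω : Set ι | ∃ a ∈ B i, a ∈ ω}) (fun j => ind {ω : Set ι | ∃ a ∈ A j, a ∈ ω})) := by
  have hμ := isFKGMeasure_bernoulliWeight p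
  exact sahiE_joinFam_nonneg hμ.nonneg hμ.sum_eq_one _ _ (fun i j => ind_hit_mul_ind_hit_of_subset (hAB i j))
    (fun i ω => ind_nonneg _ _) (fun i ω => ind_hit_le_one (B i) ω) hA

/-- **Width-≤-5 core plus supersets, every order, every product measure** (main): if among any six core indices two carry
nested sets and every `B_i` contains every `A_j`, then `E_{k+1+m}(1_{H_B}, 1_{H_A}) ≥ 0`. [this work] -/
theorem prodBernoulli_sahiE_hit_joinFam_nonneg_of_core_width_le_five (p : ι → unitInterval) {k m : ℕ}
    (A : Fin (k + 1) → Finset ι) (B : Fin m → Finset ι) (hAB : ∀ i j, A j ⊆ B i)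
    (hw : ∀ S : Finset (Fin (k + 1)), S.card = 6 → ∃ i ∈ S, ∃ j ∈ S, i ≠ j ∧ A i ⊆ A j) :
    0 ≤ sahiE (bernoulliWeight p) (k + m + 1)
      (joinFam (fun i => ind {ω : Set ι | ∃ a ∈ B i, a ∈ ω}) (fun j => ind {ω : Set ι | ∃ a ∈ A j, a ∈ ω})) :=
  prodBernoulli_sahiE_hit_joinFam_nonneg p A B hAB (prodBernoulli_sahiE_hit_nonneg_of_width_le_five p (k + 1) A hw)

/-- **A core of at most five sets plus supersets, every order, every product measure.** [this work] -/
theorem prodBernoulli_sahiE_hit_joinFam_nonneg_of_core_card_le_five (p : ι → unitInterval) {k m : ℕ} (hk : k + 1 ≤ 5)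
    (A : Fin (k + 1) → Finset ι) (B : Fin m → Finset ι) (hAB : ∀ i j, A j ⊆ B i) :
    0 ≤ sahiE (bernoulliWeight p) (k + m + 1)
      (joinFam (fun i => ind {ω : Set ι | ∃ a ∈ B i, a ∈ ω}) (fun j => ind {ω : Set ι | ∃ a ∈ A j, a ∈ ω})) :=
  prodBernoulli_sahiE_hit_joinFam_nonneg p A B hAB (prodBernoulli_sahiE_hit_nonneg_of_card_le_five p hk A)

/-! ## Two-set cores: the covariance of two hitting events and the vanishing classes -/

omit [Fintype ι] in
/-- `1_{H_A} · 1_{H_B} = 1_{H_A} + 1_{H_B} − 1_{H_{A∪B}}` (union of hitting events). [folklore] -/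
theorem ind_hit_mul_ind_hit_eq (A B : Finset ι) :
    (ind {ω : Set ι | ∃ a ∈ A, a ∈ ω}) * (ind {ω : Set ι | ∃ a ∈ B, a ∈ ω})
      = ind {ω : Set ι | ∃ a ∈ A, a ∈ ω} + ind {ω : Set ι | ∃ a ∈ B, a ∈ ω}
          + (-1 : ℝ) • ind {ω : Set ι | ∃ a ∈ A ∪ B, a ∈ ω} := by
  funext ω
  simp only [Pi.mul_apply, Pi.add_apply, Pi.smul_apply, smul_eq_mul]
  by_cases hA : ∃ a ∈ A, a ∈ ω
  · have hAB : ∃ a ∈ A ∪ B, a ∈ ω := by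
      obtain ⟨a, ha, haω⟩ := hA; exact ⟨a, Finset.mem_union_left _ ha, haω⟩
    rw [ind_of_mem (show ω ∈ {ω : Set ι | ∃ a ∈ A, a ∈ ω} from hA),
      ind_of_mem (show ω ∈ {ω : Set ι | ∃ a ∈ A ∪ B, a ∈ ω} from hAB)]
    ring
  · rw [ind_of_not_mem (show ω ∉ {ω : Set ι | ∃ a ∈ A, a ∈ ω} from hA)]
    by_cases hB : ∃ a ∈ B, a ∈ ω
    · have hAB : ∃ a ∈ A ∪ B, a ∈ ω := by
        obtain ⟨a, ha, haω⟩ := hB; exact ⟨a, Finset.mem_union_right _ ha, haω⟩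
      rw [ind_of_mem (show ω ∈ {ω : Set ι | ∃ a ∈ B, a ∈ ω} from hB),
        ind_of_mem (show ω ∈ {ω : Set ι | ∃ a ∈ A ∪ B, a ∈ ω} from hAB)]
      ring
    · have hAB : ¬ ∃ a ∈ A ∪ B, a ∈ ω := by
        rintro ⟨a, ha, haω⟩
        rcases Finset.mem_union.1 ha with h | h
        · exact hA ⟨a, h, haω⟩
        · exact hB ⟨a, h, haω⟩
      rw [ind_of_not_mem (show ω ∉ {ω : Set ι | ∃ a ∈ B, a ∈ ω} from hB),
        ind_of_not_mem (show ω ∉ {ω : Set ι | ∃ a ∈ A ∪ B, a ∈ ω} from hAB)]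
      ring

/-- **Covariance of two hitting events**: `E(1_{H_A}1_{H_B}) − E(1_{H_A})E(1_{H_B}) = Π_{c∈A∪B}(1−p_c) − Π_{c∈A}(1−p_c)·Π_{c∈B}(1−p_c)`.
[folklore; cite: Grimmett1999, §1.3 (product measure)] -/
theorem cov_hit_eq (p : ι → unitInterval) (A B : Finset ι) :
    ex (bernoulliWeight p) (ind {ω : Set ι | ∃ a ∈ A, a ∈ ω} * ind {ω : Set ι | ∃ a ∈ B, a ∈ ω})
        - ex (bernoulliWeight p) (ind {ω : Set ι | ∃ a ∈ A, a ∈ ω}) * ex (bernoulliWeight p) (ind {ω : Set ι | ∃ a ∈ B, a ∈ ω})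
      = (∏ c ∈ A ∪ B, (1 - (p c : ℝ))) - (∏ c ∈ A, (1 - (p c : ℝ))) * ∏ c ∈ B, (1 - (p c : ℝ)) := by
  rw [ind_hit_mul_ind_hit_eq, ex_add, ex_add, ex_smul, ex_ind_hit, ex_ind_hit, ex_ind_hit]
  ring

/-- Disjoint sets give uncorrelated hitting events under a product weight. [folklore] -/
theorem cov_hit_eq_zero_of_disjoint (p : ι → unitInterval) {A B : Finset ι} (hAB : Disjoint A B) :
    ex (bernoulliWeight p) (ind {ω : Set ι | ∃ a ∈ A, a ∈ ω} * ind {ω : Set ι | ∃ a ∈ B, a ∈ ω})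
      = ex (bernoulliWeight p) (ind {ω : Set ι | ∃ a ∈ A, a ∈ ω}) * ex (bernoulliWeight p) (ind {ω : Set ι | ∃ a ∈ B, a ∈ ω}) := by
  rw [← sub_eq_zero, cov_hit_eq, Finset.prod_union hAB, sub_self]

/-- **THE VANISHING CLASSES**: for DISJOINT core sets `A_0, A_1` and `B_i ⊇ A_0 ∪ A_1` (all `i`),
`E_{m+2}(1_{H_{B_0}},…,1_{H_{B_{m−1}}}, 1_{H_{A_0}}, 1_{H_{A_1}}) = 0` for every product weight. [this work] -/
theorem prodBernoulli_sahiE_hit_eq_zero_of_disjoint_core (p : ι → unitInterval) {m : ℕ} (A₀ A₁ : Finset ι)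
    (hA : Disjoint A₀ A₁) (B : Fin m → Finset ι) (h₀ : ∀ i, A₀ ⊆ B i) (h₁ : ∀ i, A₁ ⊆ B i) :
    sahiE (bernoulliWeight p) (m + 2)
      (Fin.snoc (Fin.snoc (fun i => ind {ω : Set ι | ∃ a ∈ B i, a ∈ ω})
          (ind {ω : Set ι | ∃ a ∈ A₀, a ∈ ω}) : Fin (m + 1) → Set ι → ℝ)
        (ind {ω : Set ι | ∃ a ∈ A₁, a ∈ ω}) : Fin (m + 2) → Set ι → ℝ) = 0 :=
  sahiE_snoc_snoc_eq_zero_of_cov_eq_zero _ _ _ _ (fun i => ind_hit_mul_ind_hit_of_subset (h₀ i))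
    (fun i => ind_hit_mul_ind_hit_of_subset (h₁ i)) (cov_hit_eq_zero_of_disjoint p hA)

/-- **Two-set core plus supersets, every order** (standard axioms apart from the imports): `E_{m+2}(1_{H_B}, 1_{H_{A_0}}, 1_{H_{A_1}})
= Φ_2 · Cov(1_{H_{A_0}}, 1_{H_{A_1}}) ≥ 0` since `Cov = Π_{A_0∪A_1}q · (1 − Π_{A_0∩A_1}q) ≥ 0` (Harris). [this work] -/
theorem prodBernoulli_sahiE_hit_nonneg_two_core (p : ι → unitInterval) {m : ℕ} (A₀ A₁ : Finset ι)
    (B : Fin m → Finset ι) (h₀ : ∀ i, A₀ ⊆ B i) (h₁ : ∀ i, A₁ ⊆ B i) :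
    0 ≤ sahiE (bernoulliWeight p) (m + 2)
      (Fin.snoc (Fin.snoc (fun i => ind {ω : Set ι | ∃ a ∈ B i, a ∈ ω})
          (ind {ω : Set ι | ∃ a ∈ A₀, a ∈ ω}) : Fin (m + 1) → Set ι → ℝ)
        (ind {ω : Set ι | ∃ a ∈ A₁, a ∈ ω}) : Fin (m + 2) → Set ι → ℝ) := by
  have hμ := isFKGMeasure_bernoulliWeight p
  rw [sahiE_snoc_snoc_nonneg_iff hμ.nonneg hμ.sum_eq_one _ _ _ (fun i => ind_hit_mul_ind_hit_of_subset (h₀ i))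
    (fun i => ind_hit_mul_ind_hit_of_subset (h₁ i)) (fun i ω => ind_nonneg _ _) (fun i ω => ind_hit_le_one (B i) ω),
    ← sahiE_two]
  exact prodBernoulli_sahiE_hit_nonneg_of_card_le_five p (by norm_num) ![A₀, A₁]

end SahiHitting

end Summit.CriticalPhenomena.PercolationContinuityZ3.Theorems
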